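import Summits.CriticalPhenomena.PercolationContinuityZ3.Theorems.PercNearOneGluingNoHeavyPcintOSMAssembly
import HarnessLib

/-!
# PCINT lane, PHASE 4 (kernel second-moment oriented route), step 7: the kernel-evaluable Green's-function bound

Cell `prim-pcint`, seat `prim-pcint-1` (gen 13); memo `run/shared/lean/prim/pcint/T-FIBRE-ROUTE.md` §PHASE 4.

`OSM.Gplus d q₀` (…OSMTail) is evaluated by the kernel in exact rational arithmetic WITHOUT binomial coefficients:
`V i k := Mrec i k / (k!)²` satisfies the plain convolution `V (i+1) k = Σ_{j ≤ k} V i (k−j) / (j!)²`, computed row by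
row as a list (`OSM.vrow`, sharing the previous row), and
`GplusQ d q₀ = Σ_{k<q₀d} (k!)² (vrow d (q₀d))[k] / d^{2k} + d (q₀d)! (q₀+1)² / (q₀!^d d^{q₀d} q₀)`.
**`OSM.GplusQ_cast`**: `(GplusQ d q₀ : ℝ) = Gplus d q₀`; **`OSM.criticalProb_le_of_checkOSM`**: a passed kernel check
`checkOSM d q₀ P := (GplusQ d q₀ · (10⁴ − P) ≤ P · d)` gives `p_c^bond(ℤ^d) ≤ P/10⁴`.
-/

namespace Summit.CriticalPhenomena.PercolationContinuityZ3.Theorems.Pcint.OSM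

open Finset Nat

/-- Row `i` of the table `V i k = Mrec i k / (k!)²`, `k = 0, …, K`, as a list (computable, row-by-row convolution). -/
def vrow : ℕ → ℕ → List ℚ
  | 0, K => (List.range (K + 1)).map fun k => if k = 0 then 1 else 0
  | i + 1, K =>
    let prev := vrow i K
    (List.range (K + 1)).map fun k => ∑ j ∈ range (k + 1), prev.getD (k - j) 0 / ((j ! : ℕ) : ℚ) ^ 2

/-- The finite part `Σ_{k<K} Mrec d k / d^{2k}` in kernel form. -/
def partialQ (d K : ℕ) : ℚ :=
  ∑ k ∈ range K, ((k ! : ℕ) : ℚ) ^ 2 * (vrow d K).getD k 0 / (d : ℚ) ^ (2 * k)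

/-- **The kernel form of `Gplus`.** -/
def GplusQ (d q₀ : ℕ) : ℚ :=
  partialQ d (q₀ * d) + (d : ℚ) * (((q₀ * d)! : ℕ) : ℚ) / ((((q₀ !) : ℕ) : ℚ) ^ d * (d : ℚ) ^ (q₀ * d)) *
    ((q₀ : ℚ) + 1) ^ 2 / (q₀ : ℚ)

/-- **The kernel check** for the cell `P/10⁴`: `GplusQ · (10⁴ − P) ≤ P · d`, i.e. `GplusQ/(d + GplusQ) ≤ P/10⁴`. -/
def checkOSM (d q₀ P : ℕ) : Bool :=
  decide (GplusQ d q₀ * (10000 - (P : ℚ)) ≤ (P : ℚ) * d)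

/-! ### Correctness of the row computation -/

/-- Entries of a mapped range. -/
theorem getD_map_range {α : Type*} (f : ℕ → α) (dflt : α) {K k : ℕ} (hk : k ≤ K) :
    ((List.range (K + 1)).map f).getD k dflt = f k := by
  rw [List.getD_eq_getElem?_getD, List.getElem?_map, List.getElem?_range (Nat.lt_succ_of_le hk)]
  rfl

/-- **`vrow` computes `Mrec / (k!)²`.** -/
theorem vrow_getD : ∀ (i K k : ℕ), k ≤ K → (vrow i K).getD k 0 = (Mrec i k : ℚ) / ((k ! : ℕ) : ℚ) ^ 2
  | 0, K, k, hk => by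
    rw [vrow, getD_map_range _ _ hk, Mrec]
    split_ifs with h
    · subst h; simp
    · simp
  | i + 1, K, k, hk => by
    rw [vrow, getD_map_range _ _ hk, Mrec]
    push_cast
    rw [Finset.sum_div]
    refine Finset.sum_congr rfl fun j hj => ?_
    have hjk : j ≤ k := Nat.lt_succ_iff.1 (mem_range.1 hj)
    rw [vrow_getD i K (k - j) (by omega)]
    have hch : ((k.choose j : ℕ) : ℚ) * ((j ! : ℕ) : ℚ) * (((k - j)! : ℕ) : ℚ) = ((k ! : ℕ) : ℚ) := by
      exact_mod_cast Nat.choose_mul_factorial_mul_factorial hjk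
    have hj0 : (0 : ℚ) < ((j ! : ℕ) : ℚ) := by exact_mod_cast Nat.factorial_pos _
    have hkj0 : (0 : ℚ) < (((k - j)! : ℕ) : ℚ) := by exact_mod_cast Nat.factorial_pos _
    have hk0 : (0 : ℚ) < ((k ! : ℕ) : ℚ) := by exact_mod_cast Nat.factorial_pos _
    rw [div_div, div_eq_div_iff (by positivity) (by positivity), ← hch]
    ring

/-- The finite part is the partial Green's sum (over `ℚ`). -/
theorem partialQ_eq (d K : ℕ) : partialQ d K = ∑ k ∈ range K, (Mrec d k : ℚ) / (d : ℚ) ^ (2 * k) := by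
  unfold partialQ
  refine Finset.sum_congr rfl fun k hk => ?_
  rw [vrow_getD d K k (mem_range.1 hk).le]
  have hk0 : (0 : ℚ) < ((k ! : ℕ) : ℚ) := by exact_mod_cast Nat.factorial_pos _
  rw [mul_div_assoc', mul_div_cancel_left₀ _ (by positivity)]

/-- The finite part is the partial Green's sum in kernel form (over `ℝ`). -/
theorem partialQ_cast (d K : ℕ) :
    (partialQ d K : ℝ) = ∑ k ∈ range K, (Mrec d k : ℝ) / (d : ℝ) ^ (2 * k) := by
  rw [partialQ_eq]; push_cast; rfl

/-- **`GplusQ` is `Gplus`.** -/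
theorem GplusQ_cast (d q₀ : ℕ) : (GplusQ d q₀ : ℝ) = Gplus d q₀ := by
  unfold GplusQ Gplus B
  push_cast
  rw [partialQ_cast]
  ring

/-- **From the kernel check to the cell**: `checkOSM d q₀ P = true → p_c^bond(ℤ^d) ≤ P/10⁴` (`d ≥ 5`, `q₀ ≥ 1`, `P < 10⁴`). -/
theorem criticalProb_le_of_checkOSM {d q₀ P : ℕ} (hd : 5 ≤ d) (hq₀ : 1 ≤ q₀) (hP : P < 10000)
    (h : checkOSM d q₀ P = true) :
    Literature.Probability.Percolation.criticalProb (Literature.Probability.LatticeModels.zdGraph d)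
      (0 : Literature.Probability.LatticeModels.Site d) ≤ (P : ℝ) / 10000 := by
  have hq : GplusQ d q₀ * (10000 - (P : ℚ)) ≤ (P : ℚ) * d := of_decide_eq_true h
  have hR : Gplus d q₀ * (10000 - (P : ℝ)) ≤ (P : ℝ) * d := by
    rw [← GplusQ_cast]; exact_mod_cast hq
  have hG0 : 0 ≤ Gplus d q₀ := le_trans (by simp) (sum_u_le_Gplus hd hq₀ 0)
  have hdR : (0 : ℝ) < d := by exact_mod_cast (show 0 < d by omega)
  have hP' : (P : ℝ) < 10000 := by exact_mod_cast hP
  refine criticalProb_le_of_Gplus_le hd hq₀ le_rfl ?_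
  rw [div_le_div_iff₀ (by positivity) (by norm_num)]
  nlinarith

end Summit.CriticalPhenomena.PercolationContinuityZ3.Theorems.Pcint.OSM
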